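/-
Copyright: cell `pub-ymgap` (HUMAN RULING D-0062), Track A of `YM-PLAN.md`, DAG node N20 (= NE7b); R134 acceleration seat
`pub-ymgap-dag-n20-c` (strategy s1, generation 7), module 40.  Released under the licence of the surrounding project.
-/
import Summits.QuantumFields.YangMills.Theorems.BalabanUVNodesN20LCSHullTransfer
import Summits.QuantumFields.YangMills.Theorems.BalabanUVNodesN20LCSLabelTowerAtResidualOfRecordHalves
import HarnessLib

/-!
# YM-DAG node N20 (= NE7b), row s1, module 40: THE REPAIRED DISPLAY ON BAŁABAN'S LABEL TOWER — the pinned display (module 30) and the multi-level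
# class weight bound (modules 32 ∕ 35 §3) with «LCS-j» asked ONLY on the HULL of the pinned cubes' regularity regions AND ONLY for histories
# whose (3.2) WINDOW contains the pinned cubes (off-window pins weigh zero by the support semantics)

Track A of `YM-PLAN.md` (cell `pub-ymgap`, HUMAN RULING D-0062), node **N20** = spine estimate NE7b (`T4WeightBudget.RelWeightBound`, NOT
PRINTED, NOT PROVED).  Seat `pub-ymgap-dag-n20-c` (R134, s1), generation 7, module 40 (imports module 39 `…N20LCSHullTransfer` and module 35
`…N20LCSLabelTowerAtResidualOfRecordHalves`).  Kernel theorems only: 0 `def`, 0 `sorry`, standard axioms; COUNT-NEUTRAL.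

WHY.  Module 38 (`…N20LCSWallShape`) shows the display «LCS-j ∀ X, ∀ h» cannot be met with gainful constants at consecutive pinned levels; module
39 re-derived the transfer and the pinned sub-family bound from moments on the HULL `((⋃_{c∈D} R c).biUnion (p′ ↦ boxRegion (emb p′.src) ((d+3)L+2)))`
only.  THIS FILE finishes the re-display on the object of record and adds the second restriction the object itself supplies — the (3.2) WINDOW:
* §1 **`sum_integral_op_pinned_le_of_LCS_hull`** — module 30's pinned display at level `k` on `labelTowerOfRecord A₁ ζ` (generic residual `ζ`, the
  two laws and (O4) displayed as there) from «LCS-k ON THE HULL» for the prefix's term: `Σ_{t∈E} ∫ (op k h ⟨k,t⟩)(eterm ρ₀ k h) dμ_{k+1} ≤ rate·∫ eterm`.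
* §2 **THE WINDOW** (at K0b's residual of record `ζ := zeta316OfRecord A₁`): a label whose (3.2) family is NOT inside the window
  `cubes32 k (seqOfHist k h)` of the prefix has an identically vanishing one-step image (`op_eterm_eq_zero_of_not_subset_cubes32`, module 34's
  `chiFactor_of_eterm_ne_zero_rec` read through `eterm_snoc`); hence pins `D ⊄ cubes32 k (seqOfHist k h)` weigh ZERO
  (`sum_integral_op_pinned_eq_zero_of_not_subset_cubes32`) and the pinned display needs «LCS-k on the hull» ONLY for prefixes whose window contains
  `D` (**`sum_integral_op_pinned_le_of_LCS_hullWindow`**).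
* §3 ★★★ **`sum_admS_integral_le_rec_pinnedLevels_hullWindow`** — the multi-level class weight bound of module 35 §2 with «LCS-j» displayed in the
  REPAIRED SHAPE: for `j ∈ J`, for the histories `h` of the class at level `j` WITH `D_j ⊆ cubes32 j (seqOfHist j h)`, for `X ⊆` the hull of
  `⋃_{c∈D_j} R_j c` only — `Σ_{class} ∫ eterm K′ ≤ (Π_{j<K′, j∈J} rate j)·∫ρ₀` (`PrefixExtraction.sum_admS_integral_le` with rate `1` at the free
  levels by `hpres_rec` and positivity; any pattern `E` at the free levels).
* §4 ★★★ **`sum_admS_integral_le_rec_pinnedLevels_hullWindow_of_LCS_pos`** — the same in the state of record `rhoZeroOfRecord g₀ E₀` (`g₀⁻² ≥ 4N`)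
  with «LCS-0» of record discharged inside (g2; it holds for every `X`, a fortiori on the hull): the node's first missing estimate now stands BY NAME
  as «LCS-j ON THE HULL OF WINDOW-ADMISSIBLE PINS, j ≥ 1», level-uniform — the statement of Bałaban's KIND ([Balaban1989LargeFieldI] (0.3)–(0.5),
  [Balaban1989LargeFieldII] p. 383, relativised to the term AND localised to its small-field window).

WHAT STAYS DISPLAYED ∕ LOCATED.  «LCS-j on the hull of window-admissible pins» itself ((A1c)); `hreg` ([Balaban1985Variational] Thm 1 shape); the
geometric separation making the repaired display consistent with module 38 §1 — that the hull of the regularity regions of cubes of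
`cubes32 (k+1) (σ s t) ⊆ W32 = (Ztilde4)ᶜ` misses the regularity regions of `t`'s large family inside `Zreg (σ s t) ⊆ Ztilde4` — is def-T's layer
algebra under the numeric nesting of `M`, `M₂`, `L` and the locality of `R`; not typed here.

HONEST FRAMING.  A RE-DISPLAY by the proofs of record (module 30's transport to the Haar state; `PrefixExtraction.sum_admS_integral_le`); no new
estimate.  NE7b NOT PRINTED ∕ NOT PROVED; (α)-instance 0∕1; N20 NOT discharged; typed 28∕28, discharged count untouched; one finite four-torus at
fixed `ε` — NOT ℝ⁴, NOT infinite volume, NOT OS, NOT a mass gap, NOT Clay.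

References (LOCATORS): T. Bałaban, CMP 119 (1988) 243–285 [Balaban1988Convergent] ((3.2)–(3.5) p. 265); CMP 122 (1989) 175–202
[Balaban1989LargeFieldI] ((0.1) p. 175, (0.3)–(0.5) pp. 176–177); CMP 122 (1989) 355–392 [Balaban1989LargeFieldII] ((1.79)–(1.80) pp. 383–384);
CMP 102 (1985) 277–309 [Balaban1985Variational] (Thm 1 p. 279).
-/

set_option autoImplicit false

noncomputable section

open scoped BigOperators ENNReal

namespace Summit.QuantumFields.YangMills.BalabanUVNodes.N20LCSHullDisplay

open MeasureTheory
open Literature.MathematicalPhysics.QuantumFieldTheory.Balaban1983to89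
open Literature.MathematicalPhysics.QuantumFieldTheory.Balaban1983to89.T4Continuum
open Literature.MathematicalPhysics.QuantumFieldTheory.Balaban1983to89.B14.Eq218Concrete
open Literature.MathematicalPhysics.QuantumFieldTheory.Balaban1983to89.Node00
open Summit.QuantumFields.BalabanUV.T4Continuum.B16HistoryIndexedRepr (GoodClass)
open Summit.QuantumFields.BalabanUV.T4Continuum.B16HistoryReprChain
open Summit.QuantumFields.BalabanUV.T4Continuum.NE7b.PrefixExtraction (admS admS_subset_adm sum_admS_integral_le eterm_snoc)
open Summit.QuantumFields.YangMills.BalabanUVNodes.N20LCSLabelTower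
open Summit.QuantumFields.YangMills.BalabanUVNodes.N20LCSLabelTowerClassWeight (labelChi_eq)
open Summit.QuantumFields.YangMills.BalabanUVNodes.N20LCSLabelTowerPinnedLevel
  (integral_lawOfRecord_eq measurable_rnDeriv_toReal integrable_rnDeriv_mul)
open Summit.QuantumFields.YangMills.BalabanUVNodes.N20LCSLabelTowerPinnedLevels (lcs_zero_labelTower_of_record)
open Summit.QuantumFields.YangMills.BalabanUVNodes.N20LCSLabelTowerAtResidualOfRecord
  (measurable_ωOfRecord_rec chiFactor_of_eterm_ne_zero_rec hpres_rec)
open Summit.QuantumFields.YangMills.BalabanUVNodes.N20LCSLargeFieldSparsify (zeta_nonneg_of_laws)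
open Summit.QuantumFields.YangMills.BalabanUVNodes.N20LCSAvgDominationRegion (boxRegion)
open Summit.QuantumFields.YangMills.BalabanUVNodes.N20LCSHullTransfer (abs_integral_pinnedSubfamily_le_of_moments_hull)
open ExpMeanLog (deltaSU)

variable (F : T4Family) (N : ℕ) [NeZero N] (ν : Stage7Numerics) (M : ℕ) (p : B12.RunParams) (g : ℕ → ℝ)

/-! ## §1 Module 30's pinned display at level `k` from «LCS-k ON THE HULL» (generic residual) -/

section PinnedHull

variable {A₁ : ℝ} {ζ : ZetaOfRecord F N ν M}

open Classical in
/-- ★★ **THE PINNED DISPLAY AT LEVEL `k` ON THE LABEL TOWER FROM «LCS-k ON THE HULL».**  Module 30's `sum_integral_op_pinned_le_of_LCS` with the moment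
hypothesis asked only for the level-`k` plaquette sets `X ⊆ ((⋃_{c∈D} R c).biUnion (p′ ↦ boxRegion (emb p′.src) ((d+3)L+2)))` — the hull of the pinned
cubes' regularity regions; proof of record (transport to the Haar state, module 39's hull sub-family bound). [folklore] -/
theorem sum_integral_op_pinned_le_of_LCS_hull (hζu : IsZetaUnity F N ν M ζ) (hζ : IsZetaAbsLeOne F N ν M ζ)
    (hω : ∀ (k : ℕ) (s : SeqOfRecord F ν M g p.K k) (t : LbOfRecord F ν p g k),
      Measurable fun z : cfgOfRecord F N p.K (k + 1) × cfgOfRecord F N p.K k => ωOfRecord F N ν M p g k A₁ ζ s t z.2 z.1)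
    (k : ℕ) (hk : k < p.K) {α : ℝ} (hα : 0 < α)
    (hguard : (((((F.P p.K).d + 2) * (F.P p.K).L : ℕ) : ℝ) ^ 2 / 4) * Real.sqrt (2 * (Fintype.card (Fin N) : ℝ) * α) <
      deltaSU (Fin N))
    {ρ₀ : cfgOfRecord F N p.K 0 → ℝ} (hρ : (bddMeas (cfgOfRecord F N p.K 0)).Gd ρ₀) (h0 : ∀ U, 0 ≤ ρ₀ U)
    (h : Fin k → LabelPat F ν p g) {β : ℝ} (hβ : 0 ≤ β) {C a₀ : ℝ} (hC : 0 ≤ C)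
    (D : Finset (Iχ F ν p g k)) (R : Iχ F ν p g k → Finset (Plaq (F.P p.K) (k + 1)))
    (hLS : ∀ a : ℝ, 0 ≤ a → a ≤ a₀ → ∀ X : Finset (Plaq (F.P p.K) k),
      (∀ q ∈ X, ∃ c ∈ D, ∃ p' ∈ R c, q ∈ boxRegion (emb p'.src) (((F.P p.K).d + 3) * (F.P p.K).L + 2)) →
      ∫ U, Real.exp (a * β * ∑ q ∈ X, (1 - reTr (GaugeField.plaqHol U q))) *
          (labelTowerOfRecord F N ν M p g A₁ ζ).eterm ρ₀ k h U ∂(lawOfRecord F N p.K k) ≤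
        Real.exp (C * a * X.card) * ∫ U, (labelTowerOfRecord F N ν M p g A₁ ζ).eterm ρ₀ k h U ∂(lawOfRecord F N p.K k))
    {δ : ℝ} (hδ0 : 0 ≤ δ)
    (hδ : δ * ((2 * (Fintype.card (Fin N) : ℝ) * (((F.P p.K).L : ℝ) ^ 2 + 6 * ((((F.P p.K).d + 2) * (F.P p.K).L : ℕ) : ℝ) ^ 2) ^ 2 + 2 / α) *
      (((2 * (((F.P p.K).d + 3) * (F.P p.K).L + 2) + 1) ^ (F.P p.K).d * (F.P p.K).d ^ 2 : ℕ) : ℝ)) ≤ a₀)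
    (E : Finset (LbOfRecord F ν p g k)) (hE : ∀ t ∈ E, D ⊆ t.1)
    (m : ℕ) {ε'' : ℝ} (hε : 0 ≤ ε'')
    (hm : ∀ c ∈ D, (R c).card ≤ m) (hdisj : ∀ c₁ ∈ D, ∀ c₂ ∈ D, c₁ ≠ c₂ → Disjoint (R c₁) (R c₂))
    (hreg : ∀ c ∈ D, ∀ V' : GaugeField (F.P p.K) (k + 1) (SU N),
      (∀ p' ∈ R c, dist1 (GaugeField.plaqHol V' p') < ε'') → chiFactor F N ν p g k c V' = 1) :
    ∑ t ∈ E, ∫ V', ((labelTowerOfRecord F N ν M p g A₁ ζ).op k h ⟨k, t⟩).T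
        ((labelTowerOfRecord F N ν M p g A₁ ζ).eterm ρ₀ k h) V' ∂(lawOfRecord F N p.K (k + 1)) ≤
      ((m : ℝ) * Real.exp (C * ((2 * (Fintype.card (Fin N) : ℝ) *
            (((F.P p.K).L : ℝ) ^ 2 + 6 * ((((F.P p.K).d + 2) * (F.P p.K).L : ℕ) : ℝ) ^ 2) ^ 2 + 2 / α) *
          (((2 * (((F.P p.K).d + 3) * (F.P p.K).L + 2) + 1) ^ (F.P p.K).d * (F.P p.K).d ^ 2 : ℕ) : ℝ)) *
          (((2 * (((F.P p.K).d + 3) * (F.P p.K).L + 2) + 1) ^ (F.P p.K).d * (F.P p.K).d ^ 2 : ℕ) : ℝ) * δ -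
            δ * β * (ε'' ^ 2 / (2 * (Fintype.card (Fin N) : ℝ))))) ^ D.card *
        ∫ U, (labelTowerOfRecord F N ν M p g A₁ ζ).eterm ρ₀ k h U ∂(lawOfRecord F N p.K k) := by
  set T := labelTowerOfRecord F N ν M p g A₁ ζ with hT
  set e : cfgOfRecord F N p.K k → ℝ := T.eterm ρ₀ k h with he
  set dens : cfgOfRecord F N p.K k → ℝ := fun U => ((lawOfRecord F N p.K k).rnDeriv (fieldMeasure (F.P p.K) k (SU N)) U).toReal
    with hdens
  have hk' : k ≤ p.K := hk.le
  have hegood : (bddMeas (cfgOfRecord F N p.K k)).Gd e := T.eterm_good hρ k h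
  have he0 : ∀ U, 0 ≤ e U := fun U => T.eterm_nonneg hρ h0 k h U
  have heint : Integrable e (lawOfRecord F N p.K k) := integrable_of_bddMeas _ hegood
  have hfm : Measurable fun U => dens U * e U := (measurable_rnDeriv_toReal F N p.K k).mul hegood.1
  have hf0 : ∀ U, 0 ≤ dens U * e U := fun U => mul_nonneg ENNReal.toReal_nonneg (he0 U)
  have hfi : Integrable (fun U => dens U * e U) (fieldMeasure (F.P p.K) k (SU N)) := integrable_rnDeriv_mul F N p.K k hk' heint
  -- «LCS-k on the hull» transported to the Haar state
  have hLS' : ∀ a : ℝ, 0 ≤ a → a ≤ a₀ → ∀ X : Finset (Plaq (F.P p.K) k),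
      (∀ q ∈ X, ∃ c ∈ D, ∃ p' ∈ R c, q ∈ boxRegion (emb p'.src) (((F.P p.K).d + 3) * (F.P p.K).L + 2)) →
      ∫ U, Real.exp (a * β * ∑ q ∈ X, (1 - reTr (GaugeField.plaqHol U q))) * (dens U * e U) ∂(fieldMeasure (F.P p.K) k (SU N)) ≤
        Real.exp (C * a * X.card) * ∫ U, dens U * e U ∂(fieldMeasure (F.P p.K) k (SU N)) := by
    intro a ha ha0 X hX
    have e1 : ∫ U, Real.exp (a * β * ∑ q ∈ X, (1 - reTr (GaugeField.plaqHol U q))) * (dens U * e U) ∂(fieldMeasure (F.P p.K) k (SU N)) =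
        ∫ U, Real.exp (a * β * ∑ q ∈ X, (1 - reTr (GaugeField.plaqHol U q))) * e U ∂(lawOfRecord F N p.K k) := by
      rw [integral_lawOfRecord_eq F N p.K k hk']
      exact integral_congr_ae (ae_of_all _ fun U => by ring)
    have e2 : ∫ U, dens U * e U ∂(fieldMeasure (F.P p.K) k (SU N)) = ∫ U, e U ∂(lawOfRecord F N p.K k) :=
      (integral_lawOfRecord_eq F N p.K k hk' e).symm
    rw [e1, e2]
    exact hLS a ha ha0 X hX
  -- module 39's hull sub-family bound for the Haar state `dens · e`
  have h39 := abs_integral_pinnedSubfamily_le_of_moments_hull F N ν M p g k hk hα hguard A₁ hζ (zeta_nonneg_of_laws F N ν M hζu hζ)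
    (seqOfHist F ν M p g k h) hfm hf0 hfi hβ hC D R hLS' hδ0 hδ E hE m hε hm hdisj hreg
  have hlhs : ∑ t ∈ E, ∫ V', (T.op k h ⟨k, t⟩).T e V' ∂(lawOfRecord F N p.K (k + 1)) =
      ∫ U, (∑ t ∈ E, ωOfRecord F N ν M p g k A₁ ζ (seqOfHist F ν M p g k h) t U ((avOfRecord F N p.K k).avg U)) * (dens U * e U)
        ∂(fieldMeasure (F.P p.K) k (SU N)) := by
    rw [Finset.sum_congr rfl fun t _ => hstep_labelTower F N ν M p g hω k h ⟨k, t⟩ e hegood,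
      ← integral_finsetSum _ fun t _ => integrable_labelChi_mul_eterm F N ν M p g hω hρ k h ⟨k, t⟩,
      integral_lawOfRecord_eq F N p.K k hk']
    refine integral_congr_ae (ae_of_all _ fun U => ?_)
    simp only [Finset.sum_mul, Finset.mul_sum]
    refine Finset.sum_congr rfl fun t _ => ?_
    rw [labelChi_eq F N ν M p g A₁ hζu hζ, labelAt_mk]
    ring
  have hrhs : ∫ U, dens U * e U ∂(fieldMeasure (F.P p.K) k (SU N)) = ∫ U, e U ∂(lawOfRecord F N p.K k) :=
    (integral_lawOfRecord_eq F N p.K k hk' e).symm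
  rw [hlhs, ← hrhs]
  exact (le_abs_self _).trans h39

end PinnedHull

/-! ## §2 The (3.2) window at the residual of record: off-window pins weigh zero; the pinned display needs «LCS-k on the hull» for window-admissible pins only -/

section Window

variable (A₁ : ℝ)

/-- **OFF-WINDOW LABELS HAVE VANISHING ONE-STEP IMAGES.**  At the residual of record, if the (3.2) family of the label `t` is NOT inside the window
`cubes32 k (seqOfHist k h)` of the prefix `h`, then `(op k h ⟨k,t⟩)(eterm ρ₀ k h) ≡ 0` — module 34's `chiFactor_of_eterm_ne_zero_rec` (on the support
of a term the last label's family lies in the window) read through `eterm_snoc`. [folklore] -/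
theorem op_eterm_eq_zero_of_not_subset_cubes32 (ρ₀ : cfgOfRecord F N p.K 0 → ℝ) (k : ℕ) (h : Fin k → LabelPat F ν p g)
    (t : LbOfRecord F ν p g k) (ht : ¬ t.1 ⊆ cubes32 F ν M p g k (seqOfHist F ν M p g k h)) (V' : cfgOfRecord F N p.K (k + 1)) :
    ((labelTowerOfRecord F N ν M p g A₁ (zeta316OfRecord F N ν M A₁)).op k h ⟨k, t⟩).T
        ((labelTowerOfRecord F N ν M p g A₁ (zeta316OfRecord F N ν M A₁)).eterm ρ₀ k h) V' = 0 := by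
  by_contra hne
  apply ht
  have hne' : (labelTowerOfRecord F N ν M p g A₁ (zeta316OfRecord F N ν M A₁)).eterm ρ₀ (k + 1) (Fin.snoc h ⟨k, t⟩) V' ≠ 0 := by
    rwa [eterm_snoc]
  have h1 := (chiFactor_of_eterm_ne_zero_rec F N ν M p g A₁ ρ₀ k (Fin.snoc h ⟨k, t⟩) V' hne').1
  simpa only [Fin.snoc_last, Fin.init_snoc, labelAt_mk] using h1

/-- **OFF-WINDOW PINS WEIGH ZERO**: if `D ⊄ cubes32 k (seqOfHist k h)` then every label family `E` pinning `D` has `Σ_{t∈E} ∫ (op k h ⟨k,t⟩)(eterm ρ₀ k h) dμ_{k+1} = 0`.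
[folklore] -/
theorem sum_integral_op_pinned_eq_zero_of_not_subset_cubes32 (ρ₀ : cfgOfRecord F N p.K 0 → ℝ) (k : ℕ) (h : Fin k → LabelPat F ν p g)
    (D : Finset (Iχ F ν p g k)) (hD : ¬ D ⊆ cubes32 F ν M p g k (seqOfHist F ν M p g k h))
    (E : Finset (LbOfRecord F ν p g k)) (hE : ∀ t ∈ E, D ⊆ t.1) :
    ∑ t ∈ E, ∫ V', ((labelTowerOfRecord F N ν M p g A₁ (zeta316OfRecord F N ν M A₁)).op k h ⟨k, t⟩).T
        ((labelTowerOfRecord F N ν M p g A₁ (zeta316OfRecord F N ν M A₁)).eterm ρ₀ k h) V' ∂(lawOfRecord F N p.K (k + 1)) = 0 := by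
  refine Finset.sum_eq_zero fun t ht => ?_
  have ht' : ¬ t.1 ⊆ cubes32 F ν M p g k (seqOfHist F ν M p g k h) := fun hsub => hD ((hE t ht).trans hsub)
  simp only [op_eterm_eq_zero_of_not_subset_cubes32 F N ν M p g A₁ ρ₀ k h t ht', integral_zero]

open Classical in
/-- ★★ **THE PINNED DISPLAY AT LEVEL `k` FROM «LCS-k ON THE HULL», WINDOW-ADMISSIBLE PINS ONLY** (residual of record): the moment hypothesis is asked
ONLY IF `D ⊆ cubes32 k (seqOfHist k h)` and ONLY for `X ⊆` the hull of `⋃_{c∈D} R c`; the bound `Σ_{t∈E} ∫ (op k h ⟨k,t⟩)(eterm) ≤ (m·r)^{#D}·∫ eterm` holds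
either way (off-window: the left side vanishes). [folklore] -/
theorem sum_integral_op_pinned_le_of_LCS_hullWindow (k : ℕ) (hk : k < p.K) {α : ℝ} (hα : 0 < α)
    (hguard : (((((F.P p.K).d + 2) * (F.P p.K).L : ℕ) : ℝ) ^ 2 / 4) * Real.sqrt (2 * (Fintype.card (Fin N) : ℝ) * α) <
      deltaSU (Fin N))
    {ρ₀ : cfgOfRecord F N p.K 0 → ℝ} (hρ : (bddMeas (cfgOfRecord F N p.K 0)).Gd ρ₀) (h0 : ∀ U, 0 ≤ ρ₀ U)
    (h : Fin k → LabelPat F ν p g) {β : ℝ} (hβ : 0 ≤ β) {C a₀ : ℝ} (hC : 0 ≤ C)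
    (D : Finset (Iχ F ν p g k)) (R : Iχ F ν p g k → Finset (Plaq (F.P p.K) (k + 1)))
    (hLS : D ⊆ cubes32 F ν M p g k (seqOfHist F ν M p g k h) → ∀ a : ℝ, 0 ≤ a → a ≤ a₀ → ∀ X : Finset (Plaq (F.P p.K) k),
      (∀ q ∈ X, ∃ c ∈ D, ∃ p' ∈ R c, q ∈ boxRegion (emb p'.src) (((F.P p.K).d + 3) * (F.P p.K).L + 2)) →
      ∫ U, Real.exp (a * β * ∑ q ∈ X, (1 - reTr (GaugeField.plaqHol U q))) *
          (labelTowerOfRecord F N ν M p g A₁ (zeta316OfRecord F N ν M A₁)).eterm ρ₀ k h U ∂(lawOfRecord F N p.K k) ≤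
        Real.exp (C * a * X.card) *
          ∫ U, (labelTowerOfRecord F N ν M p g A₁ (zeta316OfRecord F N ν M A₁)).eterm ρ₀ k h U ∂(lawOfRecord F N p.K k))
    {δ : ℝ} (hδ0 : 0 ≤ δ)
    (hδ : δ * ((2 * (Fintype.card (Fin N) : ℝ) * (((F.P p.K).L : ℝ) ^ 2 + 6 * ((((F.P p.K).d + 2) * (F.P p.K).L : ℕ) : ℝ) ^ 2) ^ 2 + 2 / α) *
      (((2 * (((F.P p.K).d + 3) * (F.P p.K).L + 2) + 1) ^ (F.P p.K).d * (F.P p.K).d ^ 2 : ℕ) : ℝ)) ≤ a₀)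
    (E : Finset (LbOfRecord F ν p g k)) (hE : ∀ t ∈ E, D ⊆ t.1)
    (m : ℕ) {ε'' : ℝ} (hε : 0 ≤ ε'')
    (hm : ∀ c ∈ D, (R c).card ≤ m) (hdisj : ∀ c₁ ∈ D, ∀ c₂ ∈ D, c₁ ≠ c₂ → Disjoint (R c₁) (R c₂))
    (hreg : ∀ c ∈ D, ∀ V' : GaugeField (F.P p.K) (k + 1) (SU N),
      (∀ p' ∈ R c, dist1 (GaugeField.plaqHol V' p') < ε'') → chiFactor F N ν p g k c V' = 1) :
    ∑ t ∈ E, ∫ V', ((labelTowerOfRecord F N ν M p g A₁ (zeta316OfRecord F N ν M A₁)).op k h ⟨k, t⟩).T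
        ((labelTowerOfRecord F N ν M p g A₁ (zeta316OfRecord F N ν M A₁)).eterm ρ₀ k h) V' ∂(lawOfRecord F N p.K (k + 1)) ≤
      ((m : ℝ) * Real.exp (C * ((2 * (Fintype.card (Fin N) : ℝ) *
            (((F.P p.K).L : ℝ) ^ 2 + 6 * ((((F.P p.K).d + 2) * (F.P p.K).L : ℕ) : ℝ) ^ 2) ^ 2 + 2 / α) *
          (((2 * (((F.P p.K).d + 3) * (F.P p.K).L + 2) + 1) ^ (F.P p.K).d * (F.P p.K).d ^ 2 : ℕ) : ℝ)) *
          (((2 * (((F.P p.K).d + 3) * (F.P p.K).L + 2) + 1) ^ (F.P p.K).d * (F.P p.K).d ^ 2 : ℕ) : ℝ) * δ -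
            δ * β * (ε'' ^ 2 / (2 * (Fintype.card (Fin N) : ℝ))))) ^ D.card *
        ∫ U, (labelTowerOfRecord F N ν M p g A₁ (zeta316OfRecord F N ν M A₁)).eterm ρ₀ k h U ∂(lawOfRecord F N p.K k) := by
  by_cases hD : D ⊆ cubes32 F ν M p g k (seqOfHist F ν M p g k h)
  · exact sum_integral_op_pinned_le_of_LCS_hull F N ν M p g (isZetaUnity_zeta316OfRecord A₁) (isZetaAbsLeOne_zeta316OfRecord A₁)
      (measurable_ωOfRecord_rec F N ν M p g A₁) k hk hα hguard hρ h0 h hβ hC D R (hLS hD) hδ0 hδ E hE m hε hm hdisj hreg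
  · rw [sum_integral_op_pinned_eq_zero_of_not_subset_cubes32 F N ν M p g A₁ ρ₀ k h D hD E hE]
    exact mul_nonneg (pow_nonneg (mul_nonneg (Nat.cast_nonneg _) (Real.exp_pos _).le) _)
      (integral_nonneg fun U => (labelTowerOfRecord F N ν M p g A₁ (zeta316OfRecord F N ν M A₁)).eterm_nonneg hρ h0 k h U)

end Window

/-! ## §3 The multi-level class weight bound with «LCS-j» in the repaired shape (hull + window) -/

section PinnedLevels

variable (A₁ : ℝ)

open Classical in
/-- ★★★ **THE CLASS WEIGHT BOUND ALONG A PATTERN PINNED AT THE LEVELS OF `J`, «LCS-j» ON THE HULL OF WINDOW-ADMISSIBLE PINS ONLY** (module 35 §2's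
`sum_admS_integral_le_rec_pinnedLevels` in the repaired shape of module 38): for a bounded measurable `ρ₀ ≥ 0`, pinned levels `J` with cube families
`D_j`, regularity letters `(R_j, m_j, ε″_j)`, rates `rate j` as there, and ANY label-family pattern `E` with `D_j ⊆ P(t)` for `t ∈ E j h`, `j ∈ J`: IF for
every `j ∈ J`, `j < K′`, every history `h` of the class at level `j` WHOSE WINDOW CONTAINS `D_j` (`D_j ⊆ cubes32 j (seqOfHist j h)`), every `0 ≤ a ≤ a₀ j`
and every `X ⊆ ((⋃_{c∈D_j} R_j c).biUnion boxRegion)` the moment bound holds, THEN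
`Σ_{h ∈ class K′} ∫ eterm ρ₀ K′ h dμ_{K′} ≤ (Π_{j<K′, j∈J} rate j)·∫ρ₀ dU₀`. [folklore] -/
theorem sum_admS_integral_le_rec_pinnedLevels_hullWindow {ρ₀ : cfgOfRecord F N p.K 0 → ℝ}
    (hρ : (bddMeas (cfgOfRecord F N p.K 0)).Gd ρ₀) (h0 : ∀ U, 0 ≤ ρ₀ U)
    (J : Finset ℕ) (hJ : ∀ j ∈ J, j < p.K)
    (D : (j : ℕ) → Finset (Iχ F ν p g j)) (R : (j : ℕ) → Iχ F ν p g j → Finset (Plaq (F.P p.K) (j + 1))) (m : ℕ → ℕ) (ε'' : ℕ → ℝ)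
    (hε : ∀ j ∈ J, 0 ≤ ε'' j) (hm : ∀ j ∈ J, ∀ c ∈ D j, (R j c).card ≤ m j)
    (hdisj : ∀ j ∈ J, ∀ c₁ ∈ D j, ∀ c₂ ∈ D j, c₁ ≠ c₂ → Disjoint (R j c₁) (R j c₂))
    (hreg : ∀ j ∈ J, ∀ c ∈ D j, ∀ V' : GaugeField (F.P p.K) (j + 1) (SU N),
      (∀ p' ∈ R j c, dist1 (GaugeField.plaqHol V' p') < ε'' j) → chiFactor F N ν p g j c V' = 1)
    (α β C a₀ δ rate : ℕ → ℝ) (hα : ∀ j ∈ J, 0 < α j)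
    (hguard : ∀ j ∈ J, (((((F.P p.K).d + 2) * (F.P p.K).L : ℕ) : ℝ) ^ 2 / 4) * Real.sqrt (2 * (Fintype.card (Fin N) : ℝ) * α j) <
      deltaSU (Fin N))
    (hβ : ∀ j ∈ J, 0 ≤ β j) (hC : ∀ j ∈ J, 0 ≤ C j) (hδ0 : ∀ j ∈ J, 0 ≤ δ j)
    (hδ : ∀ j ∈ J, δ j * ((2 * (Fintype.card (Fin N) : ℝ) * (((F.P p.K).L : ℝ) ^ 2 + 6 * ((((F.P p.K).d + 2) * (F.P p.K).L : ℕ) : ℝ) ^ 2) ^ 2 +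
        2 / α j) * (((2 * (((F.P p.K).d + 3) * (F.P p.K).L + 2) + 1) ^ (F.P p.K).d * (F.P p.K).d ^ 2 : ℕ) : ℝ)) ≤ a₀ j)
    (hrate : ∀ j ∈ J, rate j = ((m j : ℝ) * Real.exp (C j * ((2 * (Fintype.card (Fin N) : ℝ) *
            (((F.P p.K).L : ℝ) ^ 2 + 6 * ((((F.P p.K).d + 2) * (F.P p.K).L : ℕ) : ℝ) ^ 2) ^ 2 + 2 / α j) *
          (((2 * (((F.P p.K).d + 3) * (F.P p.K).L + 2) + 1) ^ (F.P p.K).d * (F.P p.K).d ^ 2 : ℕ) : ℝ)) *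
          (((2 * (((F.P p.K).d + 3) * (F.P p.K).L + 2) + 1) ^ (F.P p.K).d * (F.P p.K).d ^ 2 : ℕ) : ℝ) * δ j -
            δ j * β j * (ε'' j ^ 2 / (2 * (Fintype.card (Fin N) : ℝ))))) ^ (D j).card)
    (hrate0 : ∀ j ∈ J, 0 < rate j)
    (K' : ℕ) (E : (j : ℕ) → (Fin j → LabelPat F ν p g) → Finset (LbOfRecord F ν p g j)) (hE : ∀ j ∈ J, ∀ h t, t ∈ E j h → D j ⊆ t.1)
    (hLSw : ∀ j ∈ J, j < K' → ∀ h : Fin j → LabelPat F ν p g,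
      h ∈ admS (labelTowerOfRecord F N ν M p g A₁ (zeta316OfRecord F N ν M A₁)) (labelPattern F ν p g E) j →
      D j ⊆ cubes32 F ν M p g j (seqOfHist F ν M p g j h) →
      ∀ a : ℝ, 0 ≤ a → a ≤ a₀ j → ∀ X : Finset (Plaq (F.P p.K) j),
        (∀ q ∈ X, ∃ c ∈ D j, ∃ p' ∈ R j c, q ∈ boxRegion (emb p'.src) (((F.P p.K).d + 3) * (F.P p.K).L + 2)) →
        ∫ U, Real.exp (a * β j * ∑ q ∈ X, (1 - reTr (GaugeField.plaqHol U q))) *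
            (labelTowerOfRecord F N ν M p g A₁ (zeta316OfRecord F N ν M A₁)).eterm ρ₀ j h U ∂(lawOfRecord F N p.K j) ≤
          Real.exp (C j * a * X.card) * ∫ U, (labelTowerOfRecord F N ν M p g A₁ (zeta316OfRecord F N ν M A₁)).eterm ρ₀ j h U ∂(lawOfRecord F N p.K j)) :
    ∑ h ∈ admS (labelTowerOfRecord F N ν M p g A₁ (zeta316OfRecord F N ν M A₁)) (labelPattern F ν p g E) K',
        ∫ x, (labelTowerOfRecord F N ν M p g A₁ (zeta316OfRecord F N ν M A₁)).eterm ρ₀ K' h x ∂(lawOfRecord F N p.K K') ≤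
      (∏ j ∈ (Finset.range K').filter (· ∈ J), rate j) * ∫ U, ρ₀ U ∂(fieldMeasure (F.P p.K) 0 (SU N)) := by
  set T := labelTowerOfRecord F N ν M p g A₁ (zeta316OfRecord F N ν M A₁) with hT
  have key := sum_admS_integral_le T (labelPattern F ν p g E) (lawOfRecord F N p.K) ρ₀ (fun j => if j ∈ J then rate j else 1)
    (fun j => by
      by_cases hjJ : j ∈ J
      · rw [if_pos hjJ]; exact (hrate0 j hjJ).le
      · rw [if_neg hjJ]; exact zero_le_one) K'
    (fun j h hj hh => by
      by_cases hjJ : j ∈ J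
      · -- a pinned level: §2 with the sub-family `E j h`, «LCS-j» on the hull of window-admissible pins
        rw [if_pos hjJ, branch_inter_labelPattern, sum_labelPattern, hrate j hjJ]
        exact sum_integral_op_pinned_le_of_LCS_hullWindow F N ν M p g A₁ j (hJ j hjJ) (hα j hjJ) (hguard j hjJ) hρ h0 h (hβ j hjJ)
          (hC j hjJ) (D j) (R j) (hLSw j hjJ hj h hh) (hδ0 j hjJ) (hδ j hjJ) (E j h) (hE j hjJ h) (m j) (hε j hjJ) (hm j hjJ)
          (hdisj j hjJ) (hreg j hjJ)
      · -- a free level: the sub-sum over the pattern is at most the full sum, which is the term's mass (`hpres_rec`)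
        rw [if_neg hjJ, one_mul]
        calc ∑ q ∈ T.branch j h ∩ labelPattern F ν p g E j h, ∫ x, (T.op j h q).T (T.eterm ρ₀ j h) x ∂(lawOfRecord F N p.K (j + 1))
            ≤ ∑ q ∈ T.branch j h, ∫ x, (T.op j h q).T (T.eterm ρ₀ j h) x ∂(lawOfRecord F N p.K (j + 1)) :=
              Finset.sum_le_sum_of_subset_of_nonneg Finset.inter_subset_left fun q _ _ =>
                integral_nonneg fun V' => (T.op j h q).apply_nonneg (T.eterm_good hρ j h) (T.eterm_nonneg hρ h0 j h) V'
          _ = ∫ x, T.eterm ρ₀ j h x ∂(lawOfRecord F N p.K j) := hpres_rec F N ν M p g A₁ j h _ (T.eterm_good hρ j h))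
  rw [lawOfRecord_zero] at key
  rw [Finset.prod_filter]
  exact key

end PinnedLevels

/-! ## §4 In the state of record, «LCS-0» discharged inside: the wall in the repaired shape, pinned levels `j ≥ 1` only -/

section WallRepaired

variable (A₁ : ℝ)

open Classical in
/-- ★★★ **THE WALL IN THE REPAIRED SHAPE** (module 35 §3's `sum_admS_integral_le_rec_pinnedLevels_of_LCS_pos` with «LCS-j» restricted): in the state of
record `rhoZeroOfRecord g₀ E₀` (`g₀⁻² ≥ 4N`), with the level-`0` letters fixed to g2's «LCS-0» (`β 0 = g₀⁻²`, `a₀ 0 = 1∕12`, `C 0 = C₀` — a theorem for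
EVERY `X`, a fortiori on the hull) the multi-level class weight bound holds modulo `hreg` and — THE first missing estimate of N20 by name, now in the
statement of Bałaban's KIND — **«LCS-j ON THE HULL OF WINDOW-ADMISSIBLE PINS» at the pinned levels `j ≥ 1` ONLY**: for `h` in the class with
`D_j ⊆ cubes32 j (seqOfHist j h)`, `0 ≤ a ≤ a₀ j`, `X ⊆ ((⋃_{c∈D_j} R_j c).biUnion boxRegion)`,
`∫ e^{aβ_jΣ_X}·eterm ρ₀ j h dμ_j ≤ e^{C_j a #X}·∫ eterm ρ₀ j h dμ_j`. [folklore] -/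
theorem sum_admS_integral_le_rec_pinnedLevels_hullWindow_of_LCS_pos :
    ∃ C₀ : ℝ, 0 ≤ C₀ ∧ ∀ (g₀ E₀ : ℝ), 4 * N ≤ g₀⁻¹ ^ 2 →
    ∀ (J : Finset ℕ), (∀ j ∈ J, j < p.K) →
    ∀ (D : (j : ℕ) → Finset (Iχ F ν p g j)) (R : (j : ℕ) → Iχ F ν p g j → Finset (Plaq (F.P p.K) (j + 1))) (m : ℕ → ℕ) (ε'' : ℕ → ℝ),
    (∀ j ∈ J, 0 ≤ ε'' j) → (∀ j ∈ J, ∀ c ∈ D j, (R j c).card ≤ m j) →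
    (∀ j ∈ J, ∀ c₁ ∈ D j, ∀ c₂ ∈ D j, c₁ ≠ c₂ → Disjoint (R j c₁) (R j c₂)) →
    (∀ j ∈ J, ∀ c ∈ D j, ∀ V' : GaugeField (F.P p.K) (j + 1) (SU N),
      (∀ p' ∈ R j c, dist1 (GaugeField.plaqHol V' p') < ε'' j) → chiFactor F N ν p g j c V' = 1) →
    ∀ (α β C a₀ δ rate : ℕ → ℝ), (∀ j ∈ J, 0 < α j) →
    (∀ j ∈ J, (((((F.P p.K).d + 2) * (F.P p.K).L : ℕ) : ℝ) ^ 2 / 4) * Real.sqrt (2 * (Fintype.card (Fin N) : ℝ) * α j) < deltaSU (Fin N)) →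
    (∀ j ∈ J, 0 ≤ β j) → (∀ j ∈ J, 0 ≤ C j) → (∀ j ∈ J, 0 ≤ δ j) →
    (∀ j ∈ J, δ j * ((2 * (Fintype.card (Fin N) : ℝ) * (((F.P p.K).L : ℝ) ^ 2 + 6 * ((((F.P p.K).d + 2) * (F.P p.K).L : ℕ) : ℝ) ^ 2) ^ 2 +
        2 / α j) * (((2 * (((F.P p.K).d + 3) * (F.P p.K).L + 2) + 1) ^ (F.P p.K).d * (F.P p.K).d ^ 2 : ℕ) : ℝ)) ≤ a₀ j) →
    (∀ j ∈ J, rate j = ((m j : ℝ) * Real.exp (C j * ((2 * (Fintype.card (Fin N) : ℝ) *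
            (((F.P p.K).L : ℝ) ^ 2 + 6 * ((((F.P p.K).d + 2) * (F.P p.K).L : ℕ) : ℝ) ^ 2) ^ 2 + 2 / α j) *
          (((2 * (((F.P p.K).d + 3) * (F.P p.K).L + 2) + 1) ^ (F.P p.K).d * (F.P p.K).d ^ 2 : ℕ) : ℝ)) *
          (((2 * (((F.P p.K).d + 3) * (F.P p.K).L + 2) + 1) ^ (F.P p.K).d * (F.P p.K).d ^ 2 : ℕ) : ℝ) * δ j -
            δ j * β j * (ε'' j ^ 2 / (2 * (Fintype.card (Fin N) : ℝ))))) ^ (D j).card) →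
    (∀ j ∈ J, 0 < rate j) →
    β 0 = g₀⁻¹ ^ 2 → a₀ 0 = 1 / 12 → C 0 = C₀ →
    ∀ (K' : ℕ) (E : (j : ℕ) → (Fin j → LabelPat F ν p g) → Finset (LbOfRecord F ν p g j)), (∀ j ∈ J, ∀ h t, t ∈ E j h → D j ⊆ t.1) →
    -- «LCS-j» ON THE HULL OF WINDOW-ADMISSIBLE PINS, at the pinned levels `j ≥ 1` ONLY — THE wall, in the repaired shape
    (∀ j ∈ J, 1 ≤ j → j < K' → ∀ h : Fin j → LabelPat F ν p g,
      h ∈ admS (labelTowerOfRecord F N ν M p g A₁ (zeta316OfRecord F N ν M A₁)) (labelPattern F ν p g E) j →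
      D j ⊆ cubes32 F ν M p g j (seqOfHist F ν M p g j h) →
      ∀ a : ℝ, 0 ≤ a → a ≤ a₀ j → ∀ X : Finset (Plaq (F.P p.K) j),
        (∀ q ∈ X, ∃ c ∈ D j, ∃ p' ∈ R j c, q ∈ boxRegion (emb p'.src) (((F.P p.K).d + 3) * (F.P p.K).L + 2)) →
        ∫ U, Real.exp (a * β j * ∑ q ∈ X, (1 - reTr (GaugeField.plaqHol U q))) *
            (labelTowerOfRecord F N ν M p g A₁ (zeta316OfRecord F N ν M A₁)).eterm (rhoZeroOfRecord F N p.K g₀ E₀) j h U ∂(lawOfRecord F N p.K j) ≤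
          Real.exp (C j * a * X.card) *
            ∫ U, (labelTowerOfRecord F N ν M p g A₁ (zeta316OfRecord F N ν M A₁)).eterm (rhoZeroOfRecord F N p.K g₀ E₀) j h U ∂(lawOfRecord F N p.K j)) →
    ∑ h ∈ admS (labelTowerOfRecord F N ν M p g A₁ (zeta316OfRecord F N ν M A₁)) (labelPattern F ν p g E) K',
        ∫ x, (labelTowerOfRecord F N ν M p g A₁ (zeta316OfRecord F N ν M A₁)).eterm (rhoZeroOfRecord F N p.K g₀ E₀) K' h x ∂(lawOfRecord F N p.K K') ≤
      (∏ j ∈ (Finset.range K').filter (· ∈ J), rate j) * ∫ U, rhoZeroOfRecord F N p.K g₀ E₀ U ∂(fieldMeasure (F.P p.K) 0 (SU N)) := by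
  obtain ⟨C₀, hC₀, hlcs0⟩ := lcs_zero_labelTower_of_record F N ν M p g
  refine ⟨C₀, hC₀, ?_⟩
  intro g₀ E₀ hg J hJ D R m ε'' hε hm hdisj hreg α β C a₀ δ rate hα hguard hβ hC hδ0 hδ hrate hrate0 hβ0 ha0 hC0 K' E hE hLSpos
  refine sum_admS_integral_le_rec_pinnedLevels_hullWindow F N ν M p g A₁ (rhoZeroOfRecord_good F N p.K g₀ E₀)
    (fun U => (rhoZeroOfRecord_pos F N p.K g₀ E₀ U).le) J hJ D R m ε'' hε hm hdisj hreg α β C a₀ δ rate hα hguard hβ hC hδ0 hδ hrate hrate0 K' E hE ?_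
  intro j hjJ hjK h hadm hwin a ha0' haa X hX
  rcases Nat.eq_zero_or_pos j with hj0 | hjpos
  · subst hj0
    rw [hβ0, hC0]
    rw [ha0] at haa
    exact hlcs0 g₀ E₀ hg A₁ (zeta316OfRecord F N ν M A₁) h a ha0' haa X
  · exact hLSpos j hjJ hjpos hjK h hadm hwin a ha0' haa X hX

end WallRepaired

end Summit.QuantumFields.YangMills.BalabanUVNodes.N20LCSHullDisplay

end
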